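import Mathlib
import HarnessLib
import Literature.Probability.MarkovChains.MetropolisHastings

/-!
# Hierarchical (factorised) Metropolis acceptance–rejection filters are exact

Topic `Probability/MarkovChains`, sequel of `MetropolisHastings.lean` (same finite, row-kernel
conventions: `DetailedBalance`, `IsStationary`).  PUBLISHED RESULT with our formalisation of the
published (one-line) proof; no named fact is introduced.

Source: J. Finkenrath, F. Knechtli, B. Leder, *Fermions as global correction: the QCD case*,
Comput. Phys. Commun. 184 (2013) 1522 = arXiv:1204.1306, §2 "Hierarchy of acceptance steps" and
App. A.1.  Setting of §2: a proposal `T₀(s → s')` "fulfills detailed balance with respect to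
`P₀(s)`"; "If the target distribution `P(s)` factorizes into `n+1` parts
`P(s) = P₀(s) P₁(s) P₂(s) … P_n(s)`, the resulting hierarchical acceptance-rejection steps take the
form 0) Propose `s'` according to `T₀(s → s')`; 1) `P_acc^{(1)}(s → s') = min{1, P₁(s')/P₁(s)}`;
2) `P_acc^{(2)}(s → s') = min{1, P₂(s')/P₂(s)}`; …; n) `P_acc^{(n)}(s → s') = min{1, P_n(s')/P_n(s)}`"
— the result of filter `i` is the proposal for filter `i+1`, so a move survives with probability
`∏ᵢ min{1, Pᵢ(s')/Pᵢ(s)}`; "The algorithm satisfies detailed balance" (App. A.1–A.2; with `n = 1`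
this is the two-step algorithm `P_acc = min{1, P₀(s)P(s')/(P(s)P₀(s'))}` of their eq. in §2 /
App. A.1, after Hasenbusch 1999 and Knechtli–Wolff 2003).  In lattice QCD the `Pᵢ` are the factors
of an exact factorisation of the fermion determinant (block determinants, Schur complements), which
is what makes domain-decomposed and flow-based proposals with nested determinant filters exact
(R2-SCOPE.md §3 route D5 of the cell pub-lqcd).

Contents (all proved; `X` finite, index type `ι` of filters finite):
* `filterAccept P x y = ∏ᵢ min 1 (P i y / P i x)` — survival probability of the hierarchy;
  `filterKernel T₀ P` — the resulting row kernel (rejected mass on the diagonal);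
* `mul_filterAccept` — `(∏ᵢ P i x) · filterAccept P x y = ∏ᵢ min (P i x) (P i y)` (the symmetric
  form behind the one-line proof);
* `filterKernel_detailedBalance` — if `T₀` is in detailed balance with `P₀ > 0` and all `Pᵢ > 0`,
  the hierarchy is in detailed balance with `P₀ · ∏ᵢ Pᵢ` [FKL13 §2, App. A.1];
* `filterKernel_sum_eq_one`, `filterKernel_isStationary` — hence the factorised target is
  stationary;
* `filterAccept_unique` — with a single filter (`ι = Unit`) the survival probability is the
  ordinary Metropolis test `min 1 (P₁ y / P₁ x)` (the two-step algorithm).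
-/

namespace Literature.Probability.MarkovChains

open Finset

variable {X : Type*} [Fintype X] [DecidableEq X] {ι : Type*} [Fintype ι]

/-- Survival probability of the HIERARCHY of acceptance–rejection filters for a factorised target
`∏ᵢ Pᵢ`: `∏ᵢ min {1, Pᵢ(y)/Pᵢ(x)}` (filter `i` passes the move `x → y` with probability
`min{1, Pᵢ(y)/Pᵢ(x)}`, independently given the move).
[cite: FinkenrathKnechtliLeder2013, §2 (the displayed steps 1)–n), P_acc^{(i)} = min{1, P_i(s')/P_i(s)})] -/
noncomputable def filterAccept (P : ι → X → ℝ) (x y : X) : ℝ := ∏ i, min 1 (P i y / P i x)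

/-- The row kernel of "propose with `T₀`, then pass the hierarchy of filters": off the diagonal
`T₀ x y · filterAccept P x y`, the rejected mass on the diagonal.
[cite: FinkenrathKnechtliLeder2013, §2 step 0) and App. A.1 (the transition probability display
"T(U→U') = T₀(U→U') P_acc + δ(U−U')(1 − ∫ T₀ P_acc)")] -/
noncomputable def filterKernel (T₀ : X → X → ℝ) (P : ι → X → ℝ) (x y : X) : ℝ :=
  if y = x then 1 - ∑ z ∈ univ.erase x, T₀ x z * filterAccept P x z
  else T₀ x y * filterAccept P x y

/-- Off-diagonal entries of the hierarchical kernel (private helper). [folklore] -/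
private theorem filterKernel_of_ne (T₀ : X → X → ℝ) (P : ι → X → ℝ) {x y : X} (h : y ≠ x) :
    filterKernel T₀ P x y = T₀ x y * filterAccept P x y := if_neg h

/-- Diagonal entries of the hierarchical kernel (private helper). [folklore] -/
private theorem filterKernel_self (T₀ : X → X → ℝ) (P : ι → X → ℝ) (x : X) :
    filterKernel T₀ P x x = 1 - ∑ z ∈ univ.erase x, T₀ x z * filterAccept P x z := if_pos rfl

omit [Fintype X] [DecidableEq X] [Fintype ι] in
/-- One filter in symmetric form: `Pᵢ(x) · min{1, Pᵢ(y)/Pᵢ(x)} = min{Pᵢ(x), Pᵢ(y)}` for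
`Pᵢ(x) > 0` (private helper). [folklore] -/
private theorem mul_min_one_div {a b : ℝ} (ha : 0 < a) : a * min 1 (b / a) = min a b := by
  rw [(monotone_mul_left_of_nonneg ha.le).map_min, mul_one, mul_div_cancel₀ _ ha.ne']

omit [Fintype X] [DecidableEq X] in
/-- The symmetric form of the hierarchy: `(∏ᵢ Pᵢ(x)) · ∏ᵢ min{1, Pᵢ(y)/Pᵢ(x)} = ∏ᵢ min{Pᵢ(x), Pᵢ(y)}`
— the content of the detailed-balance proof ("P_i(s')/P_i(s) = e^{−Δ_i(s,s')}" filter by filter).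
[cite: FinkenrathKnechtliLeder2013, §2 and App. A.1–A.2 ("The algorithm satisfies detailed
balance")] -/
theorem mul_filterAccept {P : ι → X → ℝ} (hP : ∀ i x, 0 < P i x) (x y : X) :
    (∏ i, P i x) * filterAccept P x y = ∏ i, min (P i x) (P i y) := by
  rw [filterAccept, ← prod_mul_distrib]
  exact prod_congr rfl fun i _ => mul_min_one_div (hP i x)

/-- **Hierarchical acceptance–rejection filters are exact.**  If the proposal `T₀` fulfils
detailed balance with respect to a positive `P₀` and every factor `Pᵢ` is positive, then "propose
with `T₀`, then filter successively with `min{1, Pᵢ(s')/Pᵢ(s)}`" fulfils detailed balance with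
respect to the factorised target `P(s) = P₀(s) P₁(s) ⋯ P_n(s)`.
[cite: FinkenrathKnechtliLeder2013, §2 (hierarchy of acceptance steps) and App. A.1 ("In order
for T to satisfy detailed balance for the distribution P …, T₀ has to satisfy detailed balance for
the distribution P₀"), App. A.2 ("can be generalized to an arbitrary number of
acceptance-rejection steps … The algorithm satisfies detailed balance")] -/
theorem filterKernel_detailedBalance {T₀ : X → X → ℝ} {P₀ : X → ℝ} {P : ι → X → ℝ}
    (hT₀ : DetailedBalance P₀ T₀) (hP : ∀ i x, 0 < P i x) :
    DetailedBalance (fun x => P₀ x * ∏ i, P i x) (filterKernel T₀ P) := by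
  intro x y
  by_cases h : y = x
  · subst h; rfl
  · rw [filterKernel_of_ne T₀ P h, filterKernel_of_ne T₀ P (Ne.symm h)]
    calc P₀ x * (∏ i, P i x) * (T₀ x y * filterAccept P x y)
        = (P₀ x * T₀ x y) * ((∏ i, P i x) * filterAccept P x y) := by ring
      _ = (P₀ y * T₀ y x) * ((∏ i, P i y) * filterAccept P y x) := by
          rw [hT₀ x y, mul_filterAccept hP, mul_filterAccept hP]
          congr 1
          exact prod_congr rfl fun i _ => min_comm _ _
      _ = P₀ y * (∏ i, P i y) * (T₀ y x * filterAccept P y x) := by ring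

/-- Rows of the hierarchical kernel sum to one (by construction of the diagonal).
[cite: FinkenrathKnechtliLeder2013, App. A.1 (transition probability with the δ(U−U') term)] -/
theorem filterKernel_sum_eq_one (T₀ : X → X → ℝ) (P : ι → X → ℝ) (x : X) :
    ∑ y, filterKernel T₀ P x y = 1 := by
  rw [← add_sum_erase _ _ (mem_univ x), filterKernel_self]
  have : ∑ y ∈ univ.erase x, filterKernel T₀ P x y =
      ∑ y ∈ univ.erase x, T₀ x y * filterAccept P x y :=
    sum_congr rfl fun y hy => filterKernel_of_ne T₀ P (ne_of_mem_erase hy)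
  rw [this]
  ring

/-- **Stationarity of the factorised target** `P₀ · ∏ᵢ Pᵢ` under the hierarchy of filters ("A
process with fixed point distribution `P(s)` is then obtained").
[cite: FinkenrathKnechtliLeder2013, §2 (first paragraph) and App. A.1] -/
theorem filterKernel_isStationary {T₀ : X → X → ℝ} {P₀ : X → ℝ} {P : ι → X → ℝ}
    (hT₀ : DetailedBalance P₀ T₀) (hP : ∀ i x, 0 < P i x) :
    IsStationary (fun x => P₀ x * ∏ i, P i x) (filterKernel T₀ P) :=
  (filterKernel_detailedBalance hT₀ hP).isStationary (filterKernel_sum_eq_one T₀ P)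

omit [Fintype X] [DecidableEq X] [Fintype ι] in
/-- With a single filter the hierarchy is the ordinary two-step algorithm: survival probability
`min{1, P₁(s')/P₁(s)}` (FKL's step 1) with `P = P₀ P₁`).
[cite: FinkenrathKnechtliLeder2013, §2 (the two-step display 0)–1)) and App. A.1 eq. for
P_acc(U,U') = min{1, P₀(U)P(U')/(P(U)P₀(U'))}] -/
theorem filterAccept_unique (P₁ : X → ℝ) (x y : X) :
    filterAccept (fun _ : Unit => P₁) x y = min 1 (P₁ y / P₁ x) := by
  simp [filterAccept]

end Literature.Probability.MarkovChains
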